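import Literature.Combinatorics.StablePolynomials.ApolarityTranslation
import Literature.Combinatorics.StablePolynomials.MasterCompositionAllDegrees
import Literature.Combinatorics.StablePolynomials.SupportJumpSystem
import Literature.Combinatorics.StablePolynomials.SamePhase
import Literature.Combinatorics.StablePolynomials.Homogenization
import HarnessLib

/-!
# Half-plane apolarity (Borcea–Brändén II, §5: Lemma 5.7 and Theorem 5.8)

J. Borcea, P. Brändén, *The Lee–Yang and Pólya–Schur programs. II. Theory of stable polynomials and
applications*, Comm. Pure Appl. Math. 62 (2009) 1595–1631 (arXiv:0809.3087), §5 (verbatim, arXiv p. 15):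

> The homogeneous part of a polynomial `f ∈ ℂ[z_1,…,z_n]` is the polynomial `f_H` obtained by extracting the
> terms of maximum total degree, i.e., `f_H(z_1,…,z_n) = lim_{t→∞} t^{-d} f(tz_1,…,tz_n)`, where
> `d = max{|α| : ∂^α f/∂z^α ≠ 0}`.
>
> **Lemma 5.7.** Suppose `f ∈ ℂ[z_1,…,z_n]` is `H_0`-stable and `i ∈ [n]`. Then `(∂f/∂z_i)_H = ∂f_H/∂z_i`.
> *Proof.* Suppose that `f` has total degree `d`. Clearly, it is enough to prove that either `∂f/∂z_i` is
> identically zero or its total degree is `d - 1`. […]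
>
> **Theorem 5.8.** Let `C_1` and `C_2` be two open half-planes with non-empty intersection, `κ ∈ ℕⁿ`, and
> `f, g ∈ ℂ_κ[z_1,…,z_n]`. If `f` is `C_1`-stable, `g` is `C_2`-stable, and `κ ≤ α + β` for some `α ∈ supp(f)`,
> `β ∈ supp(g)`, then `{f,g}_κ ≠ 0`.
> *Proof.* By an affine transformation of the variables we may assume that there is an `ε > 0` such that
> `f(z - iε)` and `g(-z + iε)` are `H_0`-stable, where `ε = (ε,…,ε)`. Then so are the `2n`-variable polynomials
> `f(z + w - iε)` and `g(-z - w + iε)` and by Corollary 3.4 also the polynomial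
> `F(z,w) = Σ_{α ≤ κ} (-1)^{κ-α} f^{(α)}(w - iε) g^{(κ-α)}(-z + iε)` unless it is identically zero. If it is not
> identically zero then the conclusion of the theorem follows by setting `z = w = iε`. To complete the proof we
> show that `F(z,w)` is not identically zero. Let `G_α(z,w) = (-1)^{κ-α} f^{(α)}(w-iε) g^{(κ-α)}(-z+iε)`. This
> polynomial is `H_0`-stable or identically zero (by Remark 3.1) and by Lemma 5.7 and Lemma 4.2 all non-zero
> coefficients in its homogeneous part have the same phase as those in the homogeneous part of
> `f(w-iε) g(-z+iε)`. By the assumptions on the supports of `f` and `g` there is an `α` such that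
> `G_α(z,w) ≠ 0` so `lim_{t→∞} t^{-d-e+|κ|} F(tz,tw) ≠ 0`, where `d` and `e` are the total degrees of `f` and
> `g`, respectively. In particular, `F(z,w)` is not identically zero.

## The statement formalized, and the printed hypothesis

The conclusion of Theorem 5.8 needs more than "`C_1 ∩ C_2 ≠ ∅`": for `n = 1`, `κ = 1`, `f = z - a`, `g = z - b`
one has `{f,g}_1 = b - a` (`mvApolarForm_one_X_sub_C`), which vanishes for `a = b ∈ (ℂ ∖ C_1) ∩ (ℂ ∖ C_2)` —
possible as soon as `C_1 ∪ C_2 ≠ ℂ`, e.g. `C_1 = {Im z > 0}`, `C_2 = {Im z > Re z}`, `a = b = 1 - i`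
(`BorceaBranden_thm_5_8_printed_hypothesis_counterexample`). What the printed proof uses is its first sentence:
after ONE affine map `φ(t) = at + b` (`a ≠ 0`) of the variable, `C_1 ⊇ φ({Im t > -ε})` and `C_2 ⊇ φ({Im t < ε})`
for some `ε > 0` — equivalently, `C_1` and `C_2` are open half-planes with `C_1 ∪ C_2 = ℂ` (parallel boundary
lines, opposite orientation, overlapping in a strip). We formalize exactly this: the normalized form
`BorceaBranden_halfPlane_apolarity` (`f` zero-free on `{Im > -ε}ⁿ`, `g` zero-free on `{Im < ε}ⁿ`) and the affine
form `BorceaBranden_halfPlane_apolarity_affine`.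

## The proof formalized (deviations from the printed text)

* **Lemma 5.7** is obtained from Brändén's support theorem (the support of an `ℋ`-stable polynomial is a jump
  system; tree `IsUpperHalfPlaneStable.isJumpSystem_support`, [Branden2007] Thm. 3.2) instead of the printed
  asymptotic argument with `p(z)/q(z) = C z^{d-d'} + …`: by the two-step axiom every support point `β ≥ γ`
  forces a TOP-degree support point `α ≥ γ` (`IsUpperHalfPlaneStable.exists_top_support_ge`), so `∂^γ f ≠ 0`
  implies `∂^γ f_H ≠ 0`, whence `deg ∂^γ f = deg f - |γ|` and `(∂^γ f)_H = ∂^γ (f_H)`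
  (`IsUpperHalfPlaneStable.homogeneousPart_mixedPderiv`; the printed `i`-th partial derivative is
  `IsUpperHalfPlaneStable.homogeneousPart_pderiv`, `…totalDegree_pderiv`).
* **Corollary 3.4 (a)** is the tree's `mv_master_composition'` (`MasterCompositionAllDegrees.lean`, every `κ`);
  the polynomials `f(z + w - iε)`, `g(-z - w + iε)` are brought to its normal form
  `Σ_α binom(κ,α) P_α(w) z^α`, `Σ_α binom(κ,α) Q_α(z) w^α` by the Taylor expansion
  `p(z + w) = Σ_{α ≤ κ} z^α ∂^α p(w)/α!` (`sumSubst_eq_sum_mixedPderiv`), with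
  `P_α = ∂^α F/(binom(κ,α) α!)` (`taylorPiece`), so that the composed polynomial is `F(z,w)/κ!`
  (`mvComposition_taylorPiece`), where `F(w) = f(w - iε)`, `G(z) = g(-z + iε)` and
  `F(z,w) = Σ_α ∂^{κ-α}G(z) · ∂^α F(w)` (`compositionPoly`; note `∂_z^{κ-α}[g(-z+iε)] = (-1)^{κ-α} g^{(κ-α)}(-z+iε)`).
* **`F ≢ 0`**: the top homogeneous component of `F(z,w)` (degree `d + e - |κ|`) is the composition polynomial of
  the homogeneous parts `F_H`, `G_H` (`homogeneousComponent_compositionPoly`, via Lemma 5.7 and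
  `(AB)_{a+b} = A_a B_b`); `F_H`, `G_H` are stable (tree `IsUpperHalfPlaneStable.homogeneousComponent_totalDegree`)
  hence of one phase (Lemma 4.2 = tree `IsUpperHalfPlaneStable.hasSamePhase`), so all summands have the common
  phase `uv` (`HasPhase.mixedPderiv/rename/mul`) and no cancellation occurs (`HasPhase.sum_ne_zero`); the
  summand `α₀ = min(α, κ)` is nonzero by the support hypothesis.
* Finally `F(iε,…,iε; iε,…,iε) = (-1)^{|κ|} {f,g}_κ` and the point lies in `ℋ^{2n}`.

## Contents (namespace `Literature.Combinatorics.StablePolynomials`)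

* §1 `coeff_mixedPderiv`, `mixedPderiv_ne_zero_iff`. §2 **`IsUpperHalfPlaneStable.exists_top_support_ge`**,
  `IsUpperHalfPlaneStable.mixedPderiv_homogeneousComponent_ne_zero`. §3 `homogeneousComponent_mixedPderiv`,
  `totalDegree_mixedPderiv_le`, `IsUpperHalfPlaneStable.totalDegree_mixedPderiv`,
  **`IsUpperHalfPlaneStable.homogeneousPart_mixedPderiv`**, **`IsUpperHalfPlaneStable.homogeneousPart_pderiv`**
  (Lemma 5.7), `IsUpperHalfPlaneStable.totalDegree_pderiv`.
* §4 `sumSubst` (`p(z+w)`), `sumSubst_prod_X_pow`, **`sumSubst_eq_sum_mixedPderiv`** (Taylor expansion).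
* §5 `HasPhase` and its calculus; §6 `homogeneousComponent_mul_of_totalDegree_le`.
* §7 `compositionPoly`, `taylorPiece`, `mvCompositionF/G_taylorPiece`, `mvComposition_taylorPiece`,
  `compositionPoly_eq_zero_or_stable`. §8 `homogeneousComponent_compositionPoly`, `compositionPoly_ne_zero`,
  **`isUpperHalfPlaneStable_compositionPoly`**. §9 `affineSubst_eq_zero_iff`, `mixedPderiv_affineSubst_zero`,
  `mixedPderiv_affineSubst`.
* §10 **`BorceaBranden_halfPlane_apolarity`** (Theorem 5.8, normalized), **`BorceaBranden_halfPlane_apolarity_affine`**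
  (Theorem 5.8 for parallel half-planes covering `ℂ`). §11 `mvApolarForm_one_X_sub_C`,
  `BorceaBranden_thm_5_8_printed_hypothesis_counterexample`.

TODO(general form): the mixed circular-domain Theorem 5.6 (different `C_i`, non-convex `C_i`, genuine Möbius maps
`c_i ≠ 0`) is not treated here (`ApolarityTranslation.lean` has the equal-open-disc case).

## References

* [BorceaBranden2009II] J. Borcea, P. Brändén, Comm. Pure Appl. Math. 62 (2009) 1595–1631, §5 Lemma 5.7,
  Thm. 5.8 (and §3 Cor. 3.4 (a), §4 Lemma 4.2 used in the proof).
* [Branden2007] P. Brändén, *Polynomials with the half-plane property and matroid theory*, Adv. Math. 216 (2007)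
  302–320, Thm. 3.2 (support is a jump system) — replaces the printed proof of Lemma 5.7.
* [ChoeOxleySokalWagner2004] Y.-B. Choe, J. Oxley, A. Sokal, D. Wagner, Adv. Appl. Math. 32 (2004), Thm. 6.1 (same
  phase; = BB-II Lemma 4.2).
-/

noncomputable section

open MvPolynomial Finset

namespace Literature.Combinatorics.StablePolynomials

variable {τ : Type*} [Fintype τ] [DecidableEq τ]

/-! ## §1 Coefficients and supports of mixed derivatives -/

section Coeff

/-- **Coefficients of `∂^γ f`**: `[z^m] ∂^γ f = (m+γ)_γ · [z^{m+γ}] f`. [cite: BorceaBranden2009II, §5 (the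
derivatives `f^{(α)}`)] -/
theorem coeff_mixedPderiv (γ : τ → ℕ) (f : MvPolynomial τ ℂ) (m : τ →₀ ℕ) :
    coeff m (mixedPderiv γ f) = (multiDescFactorial (⇑(m + toF γ)) γ : ℂ) * coeff (m + toF γ) f := by
  conv_lhs => rw [f.as_sum, map_sum, coeff_sum]
  have hterm : ∀ s : τ →₀ ℕ, coeff m (mixedPderiv γ (monomial s (coeff s f))) =
      if s = m + toF γ then (multiDescFactorial (⇑(m + toF γ)) γ : ℂ) * coeff (m + toF γ) f else 0 := by
    intro s
    rw [mixedPderiv_monomial, coeff_smul, coeff_monomial, smul_eq_mul]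
    by_cases hs : s = m + toF γ
    · subst hs
      rw [if_pos (add_tsub_cancel_right _ _), if_pos rfl]
    · rw [if_neg hs]
      by_cases hle : γ ≤ ⇑s
      · rw [if_neg, mul_zero]
        intro h
        apply hs
        rw [← h, tsub_add_cancel_of_le (Finsupp.le_def.2 fun i => by rw [toF_apply]; exact hle i)]
      · rw [multiDescFactorial_eq_zero hle, Nat.cast_zero, zero_mul]
  simp only [hterm]
  rw [Finset.sum_ite_eq']
  split_ifs with hmem
  · rfl
  · rw [notMem_support_iff.1 hmem, mul_zero]

/-- `∂^γ f ≠ 0` iff some support point of `f` dominates `γ`. [cite: BorceaBranden2009II, §5 proof of Thm. 5.8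
("by the assumptions on the supports of f and g there is an α such that G_α(z,w) ≠ 0")] -/
theorem mixedPderiv_ne_zero_iff (γ : τ → ℕ) (f : MvPolynomial τ ℂ) :
    mixedPderiv γ f ≠ 0 ↔ ∃ β ∈ f.support, toF γ ≤ β := by
  constructor
  · intro h
    obtain ⟨m, hm⟩ := MvPolynomial.ne_zero_iff.1 h
    rw [coeff_mixedPderiv] at hm
    exact ⟨m + toF γ, mem_support_iff.2 (right_ne_zero_of_mul hm), le_add_self⟩
  · rintro ⟨β, hβ, hle⟩
    rw [MvPolynomial.ne_zero_iff]
    refine ⟨β - toF γ, ?_⟩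
    rw [coeff_mixedPderiv, tsub_add_cancel_of_le hle]
    exact mul_ne_zero (Nat.cast_ne_zero.2 (multiDescFactorial_ne_zero fun i => by
      simpa only [toF_apply] using Finsupp.le_def.1 hle i)) (mem_support_iff.1 hβ)

omit [Fintype τ] [DecidableEq τ] in
/-- The degree `|s|` of a support point is at most the total degree. [folklore] -/
private theorem degree_le_totalDegree {p : MvPolynomial τ ℂ} {s : τ →₀ ℕ} (hs : s ∈ p.support) :
    s.degree ≤ p.totalDegree :=
  le_totalDegree hs

omit [Fintype τ] [DecidableEq τ] in
/-- A nonzero polynomial has a support point of top degree. [folklore] -/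
private theorem exists_degree_eq_totalDegree {p : MvPolynomial τ ℂ} (hp : p ≠ 0) :
    ∃ s ∈ p.support, s.degree = p.totalDegree := by
  obtain ⟨s, hs, h⟩ := Finset.exists_mem_eq_sup p.support (support_nonempty.2 hp) (fun s => s.sum fun _ e => e)
  exact ⟨s, hs, h.symm⟩

end Coeff

/-! ## §2 Lemma 5.7: every variable of a stable polynomial occurs in its homogeneous part

Brändén's support theorem (the support of an `ℋ`-stable polynomial is a jump system, tree
`IsUpperHalfPlaneStable.isJumpSystem_support`) gives the combinatorial heart of Lemma 5.7: a support point
`β ≥ γ` forces a TOP-degree support point `α ≥ γ`. -/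

section Top

/-- **Top-degree support points dominate**: if `p` is `ℋ`-stable and `β ∈ supp p` with `γ ≤ β`, then some
support point `α` of top degree `|α| = deg p` has `γ ≤ α`. Proof: among the top-degree support points choose
`α` maximizing `Σ_i min(α_i, γ_i)`; if `α_i < γ_i` for some `i`, the step `α + e_i` towards `β` leaves the
support (degree), so by the two-step axiom some `α + e_i - e_j` (`j ≠ i`, `α_j > β_j ≥ γ_j`) is a support point
— of top degree and with a larger value of `Σ_i min(·, γ_i)`, a contradiction. (Replaces the printed analytic
proof of Lemma 5.7 — "`p(z)/q(z) = C z^{d-d'} + …`, `d - d' ≥ 2`" — by Brändén 2007, Thm. 3.2.)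
[cite: BorceaBranden2009II, §5 Lemma 5.7; Branden2007, §3 Thm. 3.2] -/
theorem IsUpperHalfPlaneStable.exists_top_support_ge {p : MvPolynomial τ ℂ} (hp : IsUpperHalfPlaneStable p)
    {β : τ →₀ ℕ} (hβ : β ∈ p.support) {γ : τ →₀ ℕ} (hγβ : γ ≤ β) :
    ∃ α ∈ p.support, α.degree = p.totalDegree ∧ γ ≤ α := by
  classical
  have hp0 : p ≠ 0 := MvPolynomial.ne_zero_iff.2 ⟨β, mem_support_iff.1 hβ⟩
  set T := p.support.filter (fun α => α.degree = p.totalDegree) with hT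
  have hTne : T.Nonempty := by
    obtain ⟨s, hs, hsd⟩ := exists_degree_eq_totalDegree hp0
    exact ⟨s, mem_filter.2 ⟨hs, hsd⟩⟩
  obtain ⟨α, hαT, hmax⟩ := Finset.exists_max_image T (fun α : τ →₀ ℕ => ∑ i, min (α i) (γ i)) hTne
  obtain ⟨hαsupp, hαdeg⟩ := mem_filter.1 hαT
  refine ⟨α, hαsupp, hαdeg, ?_⟩
  by_contra hnot
  obtain ⟨i, hi⟩ : ∃ i, α i < γ i := by
    simpa only [Finsupp.le_def, not_forall, not_le] using hnot
  have hγβi : γ i ≤ β i := Finsupp.le_def.1 hγβ i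
  -- the step `α → α + e_i` towards `β` leaves the support (degree `deg p + 1`)
  have hstep : IsStep α β (α + Finsupp.single i 1) := isStep_add_single (hi.trans_le hγβi)
  have hnotin : α + Finsupp.single i 1 ∉ {m : τ →₀ ℕ | coeff m p ≠ 0} := by
    intro hmem
    have hle := degree_le_totalDegree (mem_support_iff.2 hmem)
    rw [map_add, Finsupp.degree_single, hαdeg] at hle
    omega
  obtain ⟨δ, hδstep, hδmem⟩ :=
    hp.isJumpSystem_support (mem_support_iff.1 hαsupp) (mem_support_iff.1 hβ) hstep hnotin
  have hδsupp : δ ∈ p.support := mem_support_iff.2 hδmem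
  obtain ⟨j, ⟨hj1, hj2⟩ | ⟨hj1, hj2⟩⟩ := hδstep
  · -- `δ = α + e_i + e_j` has degree `deg p + 2`
    have hle := degree_le_totalDegree hδsupp
    rw [hj2, map_add, map_add, Finsupp.degree_single, Finsupp.degree_single, hαdeg] at hle
    omega
  · -- `α + e_i = δ + e_j` with `β_j < (α + e_i)_j`
    have hji : j ≠ i := by
      rintro rfl
      rw [Finsupp.add_apply, Finsupp.single_eq_same] at hj1
      omega
    have hαij : (α + Finsupp.single i 1 : τ →₀ ℕ) j = α j := by
      rw [Finsupp.add_apply, Finsupp.single_apply, if_neg hji.symm, add_zero]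
    rw [hαij] at hj1
    have hγj : γ j < α j := (Finsupp.le_def.1 hγβ j).trans_lt hj1
    have hδdeg : δ.degree = p.totalDegree := by
      have h := congrArg Finsupp.degree hj2
      rw [map_add, map_add, Finsupp.degree_single, Finsupp.degree_single, hαdeg] at h
      omega
    have hδT : δ ∈ T := mem_filter.2 ⟨hδsupp, hδdeg⟩
    have hcoord : ∀ k, (α + Finsupp.single i 1 : τ →₀ ℕ) k = δ k + Finsupp.single j 1 k := fun k => by
      rw [hj2, Finsupp.add_apply]
    have hmin : ∀ k, min (δ k) (γ k) = min (α k) (γ k) + if k = i then 1 else 0 := by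
      intro k
      have hk := hcoord k
      simp only [Finsupp.add_apply, Finsupp.single_apply] at hk
      by_cases hki : k = i
      · subst hki
        rw [if_pos rfl, if_neg hji] at hk
        rw [if_pos rfl]
        omega
      · rw [if_neg (Ne.symm hki)] at hk
        rw [if_neg hki, add_zero]
        by_cases hkj : k = j
        · subst hkj
          rw [if_pos rfl] at hk
          omega
        · rw [if_neg (Ne.symm hkj)] at hk
          omega
    have hsum : ∑ k, min (δ k) (γ k) = ∑ k, min (α k) (γ k) + 1 := by
      simp only [hmin]
      rw [Finset.sum_add_distrib, Finset.sum_ite_eq' univ i, if_pos (mem_univ i)]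
    have := hmax δ hδT
    omega

/-- **Lemma 5.7, support form**: if `∂^γ f ≠ 0` for an `ℋ`-stable `f` then `∂^γ` of the homogeneous part `f_H`
(the top homogeneous component) is `≠ 0`. [cite: BorceaBranden2009II, §5 Lemma 5.7] -/
theorem IsUpperHalfPlaneStable.mixedPderiv_homogeneousComponent_ne_zero {f : MvPolynomial τ ℂ}
    (hf : IsUpperHalfPlaneStable f) {γ : τ → ℕ} (hγ : mixedPderiv γ f ≠ 0) :
    mixedPderiv γ (homogeneousComponent f.totalDegree f) ≠ 0 := by
  obtain ⟨β, hβ, hle⟩ := (mixedPderiv_ne_zero_iff γ f).1 hγ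
  obtain ⟨α, hα, hαdeg, hγα⟩ := hf.exists_top_support_ge hβ hle
  refine (mixedPderiv_ne_zero_iff γ _).2 ⟨α, ?_, hγα⟩
  rw [mem_support_iff, coeff_homogeneousComponent, if_pos hαdeg]
  exact mem_support_iff.1 hα

end Top

/-! ## §3 Lemma 5.7: the homogeneous part of a derivative

"The homogeneous part of a polynomial `f ∈ ℂ[z_1,…,z_n]` is the polynomial `f_H` obtained by extracting the
terms of maximum total degree" — here `homogeneousComponent f.totalDegree f`. -/

section HomPart

/-- **Homogeneous components commute with `∂^γ` up to the shift `|γ|`**: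
`(∂^γ f)_n = ∂^γ (f_{n+|γ|})`. [cite: BorceaBranden2009II, §5 Lemma 5.7 (the identity behind
"`(∂f/∂z_i)_H = ∂f_H/∂z_i`")] -/
theorem homogeneousComponent_mixedPderiv (n : ℕ) (γ : τ → ℕ) (f : MvPolynomial τ ℂ) :
    homogeneousComponent n (mixedPderiv γ f) = mixedPderiv γ (homogeneousComponent (n + ∑ i, γ i) f) := by
  ext m
  rw [coeff_homogeneousComponent, coeff_mixedPderiv, coeff_mixedPderiv, coeff_homogeneousComponent]
  have hdeg : (m + toF γ).degree = m.degree + ∑ i, γ i := by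
    rw [map_add, Finsupp.degree_eq_sum (toF γ)]
    rfl
  rw [hdeg]
  by_cases h : m.degree = n
  · rw [if_pos h, if_pos (by rw [h])]
  · rw [if_neg h, if_neg (fun h' => h (Nat.add_right_cancel h')), mul_zero]

/-- `deg ∂^γ f ≤ deg f - |γ|`. [cite: BorceaBranden2009II, §5 proof of Lemma 5.7 ("either `∂f/∂z_i` is
identically zero or its total degree is `d - 1`": the easy inequality)] -/
theorem totalDegree_mixedPderiv_le (γ : τ → ℕ) (f : MvPolynomial τ ℂ) :
    (mixedPderiv γ f).totalDegree ≤ f.totalDegree - ∑ i, γ i := by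
  rw [totalDegree]
  refine Finset.sup_le fun s hs => ?_
  have hc : coeff (s + toF γ) f ≠ 0 := by
    have h := mem_support_iff.1 hs
    rw [coeff_mixedPderiv] at h
    exact right_ne_zero_of_mul h
  have hle := degree_le_totalDegree (mem_support_iff.2 hc)
  rw [map_add, Finsupp.degree_eq_sum (toF γ)] at hle
  change s.degree ≤ _
  have : (∑ i, (toF γ) i) = ∑ i, γ i := rfl
  omega

/-- A polynomial of total degree `< |γ|` is killed by `∂^γ`. [cite: BorceaBranden2009II, §5 (the derivatives
`f^{(α)}` on `ℂ_κ[z]`)] -/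
theorem mixedPderiv_eq_zero_of_totalDegree_lt {γ : τ → ℕ} {f : MvPolynomial τ ℂ}
    (h : f.totalDegree < ∑ i, γ i) : mixedPderiv γ f = 0 := by
  by_contra hne
  obtain ⟨β, hβ, hle⟩ := (mixedPderiv_ne_zero_iff γ f).1 hne
  have h1 := degree_le_totalDegree hβ
  have h2 : (toF γ).degree ≤ β.degree := Finsupp.degree_mono hle
  rw [Finsupp.degree_eq_sum (toF γ)] at h2
  have : (∑ i, (toF γ) i) = ∑ i, γ i := rfl
  omega

/-- **The total degree of a derivative of a stable polynomial drops exactly by the order**: for `ℋ`-stable `f`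
with `∂^γ f ≠ 0`, `|γ| ≤ deg f` and `deg ∂^γ f = deg f - |γ|`. [cite: BorceaBranden2009II, §5 proof of
Lemma 5.7 ("either `∂f/∂z_i` is identically zero or its total degree is `d - 1`")] -/
theorem IsUpperHalfPlaneStable.totalDegree_mixedPderiv {f : MvPolynomial τ ℂ} (hf : IsUpperHalfPlaneStable f)
    {γ : τ → ℕ} (hγ : mixedPderiv γ f ≠ 0) :
    ∑ i, γ i ≤ f.totalDegree ∧ (mixedPderiv γ f).totalDegree = f.totalDegree - ∑ i, γ i := by
  have hle : ∑ i, γ i ≤ f.totalDegree := by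
    by_contra h
    exact hγ (mixedPderiv_eq_zero_of_totalDegree_lt (not_le.1 h))
  refine ⟨hle, le_antisymm (totalDegree_mixedPderiv_le γ f) ?_⟩
  by_contra hlt
  have hzero := homogeneousComponent_eq_zero _ _ (not_le.1 hlt)
  rw [homogeneousComponent_mixedPderiv, Nat.sub_add_cancel hle] at hzero
  exact hf.mixedPderiv_homogeneousComponent_ne_zero hγ hzero

/-- **Borcea–Brändén II, Lemma 5.7 (mixed derivatives)**: for an `ℋ`-stable `f` and every multi-index `γ`,
the homogeneous part of `∂^γ f` is `∂^γ` of the homogeneous part of `f`: `(∂^γ f)_H = ∂^γ (f_H)`.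
[cite: BorceaBranden2009II, §5 Lemma 5.7] -/
theorem IsUpperHalfPlaneStable.homogeneousPart_mixedPderiv {f : MvPolynomial τ ℂ} (hf : IsUpperHalfPlaneStable f)
    (γ : τ → ℕ) :
    homogeneousComponent (mixedPderiv γ f).totalDegree (mixedPderiv γ f) =
      mixedPderiv γ (homogeneousComponent f.totalDegree f) := by
  by_cases hγ : mixedPderiv γ f = 0
  · rw [hγ, map_zero]
    by_cases hle : ∑ i, γ i ≤ f.totalDegree
    · have h := homogeneousComponent_mixedPderiv (f.totalDegree - ∑ i, γ i) γ f
      rw [Nat.sub_add_cancel hle, hγ, map_zero] at h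
      exact h
    · exact (mixedPderiv_eq_zero_of_totalDegree_lt
        ((homogeneousComponent_isHomogeneous _ f).totalDegree_le.trans_lt (not_le.1 hle))).symm
  · obtain ⟨hle, hdeg⟩ := hf.totalDegree_mixedPderiv hγ
    rw [hdeg, homogeneousComponent_mixedPderiv, Nat.sub_add_cancel hle]

/-- `∂^0 = id`. [cite: BorceaBranden2009II, §5 (the derivatives `f^{(α)}`, `α = 0`)] -/
theorem mixedPderiv_zero_index (f : MvPolynomial τ ℂ) : mixedPderiv (0 : τ → ℕ) f = f := by
  induction f using MvPolynomial.induction_on' with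
  | monomial s c =>
    rw [mixedPderiv_monomial, show multiDescFactorial (⇑s) 0 = 1 from Finset.prod_eq_one fun i _ => rfl,
      Nat.cast_one, one_smul, show toF (0 : τ → ℕ) = 0 from Finsupp.ext fun _ => rfl, tsub_zero]
  | add p q hp hq => rw [map_add, hp, hq]

/-- `∂_i = ∂^{e_i}`. [cite: BorceaBranden2009II, §5 (the derivatives `f^{(α)}`)] -/
theorem pderiv_eq_mixedPderiv (i : τ) (f : MvPolynomial τ ℂ) :
    MvPolynomial.pderiv i f = mixedPderiv (Function.update (0 : τ → ℕ) i 1) f := by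
  conv_lhs => rw [← mixedPderiv_zero_index f]
  rw [pderiv_mixedPderiv]
  rfl

/-- **Borcea–Brändén II, Lemma 5.7 (as printed)**: "Suppose `f ∈ ℂ[z_1,…,z_n]` is `H_0`-stable and `i ∈ [n]`.
Then `(∂f/∂z_i)_H = ∂f_H/∂z_i`." [cite: BorceaBranden2009II, §5 Lemma 5.7] -/
theorem IsUpperHalfPlaneStable.homogeneousPart_pderiv {f : MvPolynomial τ ℂ} (hf : IsUpperHalfPlaneStable f)
    (i : τ) :
    homogeneousComponent (MvPolynomial.pderiv i f).totalDegree (MvPolynomial.pderiv i f) =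
      MvPolynomial.pderiv i (homogeneousComponent f.totalDegree f) := by
  rw [pderiv_eq_mixedPderiv, pderiv_eq_mixedPderiv]
  exact hf.homogeneousPart_mixedPderiv _

/-- Lemma 5.7 in degree form: for `ℋ`-stable `f`, either `∂f/∂z_i ≡ 0` or its total degree is `deg f - 1`
("Clearly, it is enough to prove that either `∂f/∂z_i` is identically zero or its total degree is `d - 1`").
[cite: BorceaBranden2009II, §5 proof of Lemma 5.7] -/
theorem IsUpperHalfPlaneStable.totalDegree_pderiv {f : MvPolynomial τ ℂ} (hf : IsUpperHalfPlaneStable f)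
    (i : τ) : MvPolynomial.pderiv i f = 0 ∨
      (1 ≤ f.totalDegree ∧ (MvPolynomial.pderiv i f).totalDegree = f.totalDegree - 1) := by
  by_cases h : MvPolynomial.pderiv i f = 0
  · exact Or.inl h
  · right
    rw [pderiv_eq_mixedPderiv] at h ⊢
    have key := hf.totalDegree_mixedPderiv h
    have hsum : ∑ j, Function.update (0 : τ → ℕ) i 1 j = 1 := by
      rw [Finset.sum_eq_single i (fun j _ hj => by rw [Function.update_of_ne hj]; rfl)
        (fun hi => absurd (mem_univ i) hi), Function.update_self]
    rw [hsum] at key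
    exact key

end HomPart

/-! ## §4 Taylor expansion: `p(z + w) = Σ_α z^α ∂^α p(w) / α!` -/

section Taylor

/-- **`p ↦ p(z + w)`**, the substitution `z_i ↦ z_i + w_i` into polynomials on `τ ⊕ τ` (`z_i = X (inl i)`,
`w_i = X (inr i)`) — the polynomials "`f(z + w - iε)`" of the proof of Theorem 5.8.
[cite: BorceaBranden2009II, §5 proof of Thm. 5.8] -/
def sumSubst : MvPolynomial τ ℂ →ₐ[ℂ] MvPolynomial (τ ⊕ τ) ℂ :=
  bind₁ fun i => X (Sum.inl i) + X (Sum.inr i)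

omit [Fintype τ] [DecidableEq τ] in
/-- `p(z+w)` pointwise. [cite: BorceaBranden2009II, §5 proof of Thm. 5.8] -/
theorem eval_sumSubst (p : MvPolynomial τ ℂ) (v : τ ⊕ τ → ℂ) :
    eval v (sumSubst p) = eval (fun i => v (Sum.inl i) + v (Sum.inr i)) p := by
  rw [sumSubst, eval_bind₁]
  simp only [map_add, eval_X]

omit [Fintype τ] [DecidableEq τ] in
/-- **`p(z + w)` is `ℋ`-stable when `p` is** ("Then so are the `2n`-variable polynomials `f(z+w-iε)` and
`g(-z-w+iε)`"). [cite: BorceaBranden2009II, §5 proof of Thm. 5.8] -/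
theorem IsUpperHalfPlaneStable.sumSubst {p : MvPolynomial τ ℂ} (hp : IsUpperHalfPlaneStable p) :
    IsUpperHalfPlaneStable (sumSubst p) := fun v hv => by
  rw [eval_sumSubst]
  exact hp _ fun i => by rw [Complex.add_im]; exact add_pos (hv _) (hv _)

omit [Fintype τ] [DecidableEq τ] in
/-- `z ↔ w` fixes `p(z+w)`. [cite: BorceaBranden2009II, §5 proof of Thm. 5.8] -/
theorem rename_swap_sumSubst (p : MvPolynomial τ ℂ) : rename Sum.swap (sumSubst p) = sumSubst p := by
  have h : (fun i => rename Sum.swap (X (Sum.inl i) + X (Sum.inr i) : MvPolynomial (τ ⊕ τ) ℂ)) =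
      fun i => X (Sum.inl i) + X (Sum.inr i) := funext fun i => by
    rw [map_add, rename_X, rename_X, Sum.swap_inl, Sum.swap_inr, add_comm]
  rw [sumSubst, rename_bind₁, h]

omit [Fintype τ] [DecidableEq τ] in
/-- `sumSubst` on a monomial: `Π_i (z_i + w_i)^{m_i}`. [cite: BorceaBranden2009II, §5 proof of Thm. 5.8] -/
theorem sumSubst_prod_X_pow_eq [Fintype τ] (m : τ → ℕ) :
    sumSubst (∏ i, (X i : MvPolynomial τ ℂ) ^ m i) =
      ∏ i, (X (Sum.inl i) + X (Sum.inr i) : MvPolynomial (τ ⊕ τ) ℂ) ^ m i := by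
  rw [sumSubst, map_prod]
  simp only [map_pow, bind₁_X_right]

/-- `∂^α (z^m) = (m)_α z^{m-α}` in product form, renamed to the `w`-variables.
[cite: BorceaBranden2009II, §5 proof of Thm. 5.8] -/
theorem rename_inr_mixedPderiv_prod_X_pow (α m : τ → ℕ) :
    rename Sum.inr (mixedPderiv α (∏ i, (X i : MvPolynomial τ ℂ) ^ m i)) =
      (multiDescFactorial m α : ℂ) • ∏ i, (X (Sum.inr i) : MvPolynomial (τ ⊕ τ) ℂ) ^ (m i - α i) := by
  have htoF : toF m - toF α = toF (m - α) := Finsupp.ext fun i => by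
    simp only [Finsupp.tsub_apply, toF_apply, Pi.sub_apply]
  rw [prod_X_pow_eq_monomial_toF, mixedPderiv_monomial, map_smul,
    show multiDescFactorial (⇑(toF m)) α = multiDescFactorial m α from rfl, htoF, ← prod_X_pow_eq_monomial_toF,
    map_prod]
  simp only [map_pow, rename_X, Pi.sub_apply]

omit [DecidableEq τ] in
/-- `(m)_α / α! = Π_i binom(m_i, α_i)` (as complex numbers). [folklore] -/
private theorem inv_factorial_mul_multiDescFactorial (α m : τ → ℕ) :
    (∏ i, ((α i).factorial : ℂ))⁻¹ * (multiDescFactorial m α : ℂ) = ∏ i, (((m i).choose (α i) : ℕ) : ℂ) := by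
  rw [multiDescFactorial, Nat.cast_prod, ← Finset.prod_inv_distrib, ← Finset.prod_mul_distrib]
  refine Finset.prod_congr rfl fun i _ => ?_
  rw [Nat.descFactorial_eq_factorial_mul_choose, Nat.cast_mul,
    inv_mul_cancel_left₀ (Nat.cast_ne_zero.2 (Nat.factorial_ne_zero _))]

/-- The monomial case of the Taylor expansion: `(z+w)^m = Σ_{α ≤ κ} z^α ∂^α(w^m)/α!` for `m ≤ κ` (the
binomial theorem in every variable). [cite: BorceaBranden2009II, §5 proof of Thm. 5.8 (the expansions of
`f(z+w-iε)`, `g(-z-w+iε)` in the form of Cor. 3.4)] -/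
theorem sumSubst_prod_X_pow {κ m : τ → ℕ} (hm : ∀ i, m i ≤ κ i) :
    sumSubst (∏ i, (X i : MvPolynomial τ ℂ) ^ m i) =
      ∑ α ∈ Fintype.piFinset (fun i => range (κ i + 1)),
        (∏ i, ((α i).factorial : ℂ))⁻¹ •
          ((∏ i, (X (Sum.inl i) : MvPolynomial (τ ⊕ τ) ℂ) ^ α i) *
            rename Sum.inr (mixedPderiv α (∏ i, (X i : MvPolynomial τ ℂ) ^ m i))) := by
  classical
  -- the terms: `z^α ∂^α(w^m)/α! = [α ≤ m] Π_i z_i^{α_i} w_i^{m_i-α_i} binom(m_i,α_i)`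
  have hterm : ∀ α : τ → ℕ, (∏ i, ((α i).factorial : ℂ))⁻¹ •
      ((∏ i, (X (Sum.inl i) : MvPolynomial (τ ⊕ τ) ℂ) ^ α i) *
        rename Sum.inr (mixedPderiv α (∏ i, (X i : MvPolynomial τ ℂ) ^ m i))) =
      if α ≤ m then ∏ i, ((X (Sum.inl i) : MvPolynomial (τ ⊕ τ) ℂ) ^ α i * X (Sum.inr i) ^ (m i - α i) *
        ((m i).choose (α i) : MvPolynomial (τ ⊕ τ) ℂ)) else 0 := by
    intro α
    rw [rename_inr_mixedPderiv_prod_X_pow]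
    split_ifs with hle
    · rw [mul_smul_comm, smul_smul, inv_factorial_mul_multiDescFactorial, ← Finset.prod_mul_distrib,
        Finset.prod_mul_distrib (f := fun i => (X (Sum.inl i) : MvPolynomial (τ ⊕ τ) ℂ) ^ α i * X (Sum.inr i) ^
          (m i - α i)), smul_eq_C_mul, mul_comm, map_prod]
      refine congrArg _ (Finset.prod_congr rfl fun i _ => ?_)
      rw [map_natCast]
    · rw [multiDescFactorial_eq_zero hle, Nat.cast_zero, zero_smul, mul_zero, smul_zero]
  rw [Finset.sum_congr rfl fun α _ => hterm α, ← Finset.sum_filter]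
  have hfilter : (Fintype.piFinset (fun i => range (κ i + 1))).filter (fun α => α ≤ m) =
      Fintype.piFinset (fun i => range (m i + 1)) := by
    ext α
    rw [mem_filter, mem_box_iff, mem_box_iff, Pi.le_def]
    exact ⟨fun h => h.2, fun h => ⟨fun i => (h i).trans (hm i), h⟩⟩
  rw [hfilter, sumSubst_prod_X_pow_eq, Finset.prod_congr rfl fun i _ => add_pow _ _ (m i),
    Finset.prod_univ_sum]

/-- **Taylor expansion** of a polynomial of `ℂ_κ[z]`: `p(z + w) = Σ_{α ≤ κ} z^α · (∂^α p)(w) / α!`.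
[cite: BorceaBranden2009II, §5 proof of Thm. 5.8 (the polynomials `f(z+w-iε)`, `g(-z-w+iε)` are of the form
`Σ_α binom(κ,α) P_α(w) z^α`, `Σ_α binom(κ,α) Q_α(z) w^α` of Cor. 3.4)] -/
theorem sumSubst_eq_sum_mixedPderiv {κ : τ → ℕ} {p : MvPolynomial τ ℂ} (hp : ∀ i, degreeOf i p ≤ κ i) :
    sumSubst p = ∑ α ∈ Fintype.piFinset (fun i => range (κ i + 1)),
      (∏ i, ((α i).factorial : ℂ))⁻¹ •
        ((∏ i, (X (Sum.inl i) : MvPolynomial (τ ⊕ τ) ℂ) ^ α i) * rename Sum.inr (mixedPderiv α p)) := by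
  rw [eq_sum_box hp]
  simp only [map_sum, map_smul, Finset.mul_sum, Finset.smul_sum]
  rw [Finset.sum_comm]
  refine Finset.sum_congr rfl fun m hm => ?_
  rw [sumSubst_prod_X_pow (mem_box_iff.1 hm), Finset.smul_sum]
  refine Finset.sum_congr rfl fun α _ => ?_
  rw [smul_comm, mul_smul_comm]

end Taylor

/-! ## §5 Coefficients of one phase -/

section Phase

omit [Fintype τ] [DecidableEq τ] in
/-- "All non-zero coefficients of `e^{-iφ} p` are positive": after multiplication by the unit `u = e^{-iφ}` every
coefficient is a nonnegative real (the same-phase property with a GIVEN phase). [cite: BorceaBranden2009II, §4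
(definition of the same-phase property before Lemma 4.2)] -/
def HasPhase {σ : Type*} (u : ℂ) (p : MvPolynomial σ ℂ) : Prop :=
  ∀ m, (u * coeff m p).im = 0 ∧ 0 ≤ (u * coeff m p).re

omit [Fintype τ] [DecidableEq τ] in
/-- Unfolding. [cite: BorceaBranden2009II, §4] -/
theorem hasPhase_iff {σ : Type*} (u : ℂ) (p : MvPolynomial σ ℂ) :
    HasPhase u p ↔ ∀ m, (u * coeff m p).im = 0 ∧ 0 ≤ (u * coeff m p).re := Iff.rfl

omit [Fintype τ] [DecidableEq τ] in
/-- The same-phase property provides a phase. [cite: BorceaBranden2009II, §4 Lemma 4.2] -/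
theorem HasSamePhase.exists_hasPhase {σ : Type*} {p : MvPolynomial σ ℂ} (h : HasSamePhase p) :
    ∃ u : ℂ, ‖u‖ = 1 ∧ HasPhase u p := h

/-- A natural multiple keeps the phase. [folklore] -/
private theorem natCast_mul_phase {u c : ℂ} (n : ℕ) (h : (u * c).im = 0 ∧ 0 ≤ (u * c).re) :
    (u * ((n : ℂ) * c)).im = 0 ∧ 0 ≤ (u * ((n : ℂ) * c)).re := by
  rw [mul_left_comm]
  have him : ((n : ℂ) * (u * c)).im = n * (u * c).im := by simp [Complex.mul_im]
  have hre : ((n : ℂ) * (u * c)).re = n * (u * c).re := by simp [Complex.mul_re, h.1]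
  rw [him, hre, h.1, mul_zero]
  exact ⟨rfl, mul_nonneg n.cast_nonneg h.2⟩

/-- `∂^γ` keeps the phase (its coefficients are natural multiples of the old ones).
[cite: BorceaBranden2009II, §5 proof of Thm. 5.8 ("all non-zero coefficients in its homogeneous part have the
same phase as those in the homogeneous part of `f(w-iε)g(-z+iε)`")] -/
theorem HasPhase.mixedPderiv {u : ℂ} {p : MvPolynomial τ ℂ} (h : HasPhase u p) (γ : τ → ℕ) :
    HasPhase u (mixedPderiv γ p) := fun m => by
  rw [coeff_mixedPderiv]
  exact natCast_mul_phase _ (h _)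

omit [Fintype τ] [DecidableEq τ] in
/-- Renaming along an injection keeps the phase (same set of coefficients).
[cite: BorceaBranden2009II, §5 proof of Thm. 5.8] -/
theorem HasPhase.rename {σ σ' : Type*} {u : ℂ} {p : MvPolynomial σ ℂ} (h : HasPhase u p) {e : σ → σ'}
    (he : Function.Injective e) : HasPhase u (rename e p) := fun m => by
  classical
  by_cases hm : ∃ d : σ →₀ ℕ, d.mapDomain e = m
  · obtain ⟨d, rfl⟩ := hm
    rw [coeff_rename_mapDomain e he]
    exact h d
  · rw [coeff_rename_eq_zero e p m fun d hd => absurd ⟨d, hd⟩ hm, mul_zero]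
    simp

omit [Fintype τ] in
/-- Products multiply phases. [cite: BorceaBranden2009II, §5 proof of Thm. 5.8 (the phase of
`f^{(α)}(w-iε) g^{(κ-α)}(-z+iε)`)] -/
theorem HasPhase.mul {σ : Type*} [DecidableEq σ] {u v : ℂ} {p q : MvPolynomial σ ℂ} (hp : HasPhase u p)
    (hq : HasPhase v q) : HasPhase (u * v) (p * q) := fun m => by
  rw [coeff_mul, Finset.mul_sum]
  have hterm : ∀ x ∈ Finset.HasAntidiagonal.antidiagonal m, (u * v * (coeff x.1 p * coeff x.2 q)).im = 0 ∧
      0 ≤ (u * v * (coeff x.1 p * coeff x.2 q)).re := by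
    intro x _
    have h1 := hp x.1
    have h2 := hq x.2
    rw [show u * v * (coeff x.1 p * coeff x.2 q) = (u * coeff x.1 p) * (v * coeff x.2 q) by ring]
    constructor
    · rw [Complex.mul_im, h1.1, h2.1]
      ring
    · rw [Complex.mul_re, h1.1, h2.1, mul_zero, sub_zero]
      exact mul_nonneg h1.2 h2.2
  refine ⟨?_, ?_⟩
  · rw [Complex.im_sum]
    exact Finset.sum_eq_zero fun x hx => (hterm x hx).1
  · rw [Complex.re_sum]
    exact Finset.sum_nonneg fun x hx => (hterm x hx).2

omit [Fintype τ] [DecidableEq τ] in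
/-- Sums keep a common phase. [cite: BorceaBranden2009II, §5 proof of Thm. 5.8] -/
theorem HasPhase.sum {σ ι : Type*} {u : ℂ} {s : Finset ι} {p : ι → MvPolynomial σ ℂ}
    (h : ∀ k ∈ s, HasPhase u (p k)) : HasPhase u (∑ k ∈ s, p k) := fun m => by
  rw [coeff_sum, Finset.mul_sum, Complex.im_sum, Complex.re_sum]
  exact ⟨Finset.sum_eq_zero fun k hk => (h k hk m).1, Finset.sum_nonneg fun k hk => (h k hk m).2⟩

omit [Fintype τ] [DecidableEq τ] in
/-- **No cancellation among polynomials of one phase**: a sum of polynomials of a common phase `u` (`|u| = 1`)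
vanishes only if every summand does. [cite: BorceaBranden2009II, §5 proof of Thm. 5.8 ("there is an `α` such
that `G_α(z,w) ≠ 0` so `lim_{t→∞} t^{-d-e+|κ|} F(tz,tw) ≠ 0`")] -/
theorem HasPhase.sum_ne_zero {σ ι : Type*} {u : ℂ} (hu : ‖u‖ = 1) {s : Finset ι} {p : ι → MvPolynomial σ ℂ}
    (h : ∀ k ∈ s, HasPhase u (p k)) {k₀ : ι} (hk₀ : k₀ ∈ s) (hne : p k₀ ≠ 0) : ∑ k ∈ s, p k ≠ 0 := by
  obtain ⟨m, hm⟩ := MvPolynomial.ne_zero_iff.1 hne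
  have hpos : 0 < (u * coeff m (p k₀)).re := by
    have h0 := h k₀ hk₀ m
    rcases h0.2.lt_or_eq with hlt | heq
    · exact hlt
    · exfalso
      have hz : u * coeff m (p k₀) = 0 := Complex.ext (by rw [← heq]; rfl) (by rw [h0.1]; rfl)
      rcases mul_eq_zero.1 hz with hu0 | hc
      · rw [hu0, norm_zero] at hu
        exact zero_ne_one hu
      · exact hm hc
  intro hsum
  have hcoeff : (u * coeff m (∑ k ∈ s, p k)).re = 0 := by rw [hsum, coeff_zero, mul_zero, Complex.zero_re]
  rw [coeff_sum, Finset.mul_sum, Complex.re_sum] at hcoeff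
  have hle : (u * coeff m (p k₀)).re ≤ ∑ k ∈ s, (u * coeff m (p k)).re :=
    Finset.single_le_sum (fun k hk => (h k hk m).2) hk₀
  rw [hcoeff] at hle
  exact absurd hle (not_le.2 hpos)

end Phase

/-! ## §6 Top homogeneous components of products -/

section TopProduct

omit [Fintype τ] in
/-- **The top component of a product**: if `deg A ≤ a` and `deg B ≤ b` then `(AB)_{a+b} = A_a B_b`.
[cite: BorceaBranden2009II, §5 proof of Thm. 5.8 (the homogeneous part of `f^{(α)}(w-iε) g^{(κ-α)}(-z+iε)`)] -/
theorem homogeneousComponent_mul_of_totalDegree_le {σ : Type*} [DecidableEq σ] {A B : MvPolynomial σ ℂ}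
    {a b : ℕ} (hA : A.totalDegree ≤ a) (hB : B.totalDegree ≤ b) :
    homogeneousComponent (a + b) (A * B) = homogeneousComponent a A * homogeneousComponent b B := by
  ext m
  rw [coeff_homogeneousComponent, coeff_mul, coeff_mul]
  have hdegA : ∀ d, coeff d A ≠ 0 → d.degree ≤ a := fun d hd => (le_totalDegree (mem_support_iff.2 hd)).trans hA
  have hdegB : ∀ d, coeff d B ≠ 0 → d.degree ≤ b := fun d hd => (le_totalDegree (mem_support_iff.2 hd)).trans hB
  split_ifs with hm
  · refine Finset.sum_congr rfl fun x hx => ?_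
    rw [coeff_homogeneousComponent, coeff_homogeneousComponent]
    have hx' : x.1 + x.2 = m := Finset.HasAntidiagonal.mem_antidiagonal.1 hx
    have hdeg : x.1.degree + x.2.degree = a + b := by rw [← map_add, hx', hm]
    by_cases h1 : coeff x.1 A = 0
    · rw [h1]; simp
    by_cases h2 : coeff x.2 B = 0
    · rw [h2]; simp
    have ha := hdegA _ h1
    have hb := hdegB _ h2
    rw [if_pos (by omega), if_pos (by omega)]
  · symm
    refine Finset.sum_eq_zero fun x hx => ?_
    rw [coeff_homogeneousComponent, coeff_homogeneousComponent]
    have hx' : x.1 + x.2 = m := Finset.HasAntidiagonal.mem_antidiagonal.1 hx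
    split_ifs with h1 h2
    · exfalso
      apply hm
      rw [← hx', map_add, h1, h2]
    · rw [mul_zero]
    · rw [zero_mul]
    · rw [zero_mul]

end TopProduct

/-! ## §7 The composition polynomial `F(z,w) = Σ_{α ≤ κ} ∂^{κ-α}G(z) · ∂^α F(w)` and its stability -/

section Composition

/-- **`F(z,w) = Σ_{α ≤ κ} (∂^{κ-α} G)(z) · (∂^α F)(w)`** (`z_i = X (inl i)`, `w_i = X (inr i)`) — with
`F(w) = f(w - iε)`, `G(z) = g(-z + iε)` this is the polynomial
"`F(z,w) = Σ_{α ≤ κ} (-1)^{κ-α} f^{(α)}(w - iε) g^{(κ-α)}(-z + iε)`" of the proof of Theorem 5.8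
(note `∂_z^{κ-α}[g(-z+iε)] = (-1)^{κ-α} g^{(κ-α)}(-z+iε)`). [cite: BorceaBranden2009II, §5 proof of Thm. 5.8] -/
def compositionPoly (κ : τ → ℕ) (F G : MvPolynomial τ ℂ) : MvPolynomial (τ ⊕ τ) ℂ :=
  ∑ α ∈ Fintype.piFinset (fun i => range (κ i + 1)),
    rename Sum.inl (mixedPderiv (κ - α) G) * rename Sum.inr (mixedPderiv α F)

/-- Unfolding. [cite: BorceaBranden2009II, §5 proof of Thm. 5.8] -/
theorem compositionPoly_def (κ : τ → ℕ) (F G : MvPolynomial τ ℂ) :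
    compositionPoly κ F G = ∑ α ∈ Fintype.piFinset (fun i => range (κ i + 1)),
      rename Sum.inl (mixedPderiv (κ - α) G) * rename Sum.inr (mixedPderiv α F) := rfl

/-- The binomial-weighted pieces `P_α = ∂^α F / (binom(κ,α) α!)` of the Taylor expansion in the normal form of
Corollary 3.4. [cite: BorceaBranden2009II, §3 Cor. 3.4 (the form `Σ_α binom(κ,α) P_α(w) z^α`)] -/
def taylorPiece (κ : τ → ℕ) (F : MvPolynomial τ ℂ) (α : τ → ℕ) : MvPolynomial τ ℂ :=
  ((∏ i, (((κ i).choose (α i) : ℕ) : ℂ)) * ∏ i, ((α i).factorial : ℂ))⁻¹ • mixedPderiv α F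

omit [DecidableEq τ] in
/-- The binomial weights are nonzero on the box. [folklore] -/
private theorem prod_choose_box_ne_zero {κ α : τ → ℕ} (hα : ∀ i, α i ≤ κ i) :
    (∏ i, (((κ i).choose (α i) : ℕ) : ℂ)) ≠ 0 :=
  Finset.prod_ne_zero_iff.2 fun i _ => Nat.cast_ne_zero.2 (Nat.choose_pos (hα i)).ne'

omit [DecidableEq τ] in
/-- Factorials are nonzero. [folklore] -/
private theorem prod_factorial_box_ne_zero (α : τ → ℕ) : (∏ i, ((α i).factorial : ℂ)) ≠ 0 :=
  Finset.prod_ne_zero_iff.2 fun _ _ => Nat.cast_ne_zero.2 (Nat.factorial_ne_zero _)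

/-- **`f(z,w) := Σ_α binom(κ,α) P_α(w) z^α = F(z + w)`** for the Taylor pieces `P_α`.
[cite: BorceaBranden2009II, §5 proof of Thm. 5.8; §3 Cor. 3.4] -/
theorem mvCompositionF_taylorPiece {κ : τ → ℕ} {F : MvPolynomial τ ℂ} (hF : ∀ i, degreeOf i F ≤ κ i) :
    mvCompositionF κ (taylorPiece κ F) = sumSubst F := by
  rw [sumSubst_eq_sum_mixedPderiv hF, mvCompositionF]
  refine Finset.sum_congr rfl fun α hα => ?_
  rw [taylorPiece, map_smul, mul_smul_comm, smul_smul, mul_inv, ← mul_assoc,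
    mul_inv_cancel₀ (prod_choose_box_ne_zero (mem_box_iff.1 hα)), one_mul]

/-- **`g(z,w) := Σ_α binom(κ,α) Q_α(z) w^α = G(z + w)`** for the Taylor pieces `Q_α`.
[cite: BorceaBranden2009II, §5 proof of Thm. 5.8; §3 Cor. 3.4] -/
theorem mvCompositionG_taylorPiece {κ : τ → ℕ} {G : MvPolynomial τ ℂ} (hG : ∀ i, degreeOf i G ≤ κ i) :
    mvCompositionG κ (taylorPiece κ G) = sumSubst G := by
  rw [← rename_swap_mvCompositionF, mvCompositionF_taylorPiece hG, rename_swap_sumSubst]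

/-- **`h(z,w) := Σ_α binom(κ,α) P_α(w) Q_{κ-α}(z) = F(z,w)/κ!`.** [cite: BorceaBranden2009II, §5 proof of
Thm. 5.8; §3 Cor. 3.4 (a)] -/
theorem mvComposition_taylorPiece (κ : τ → ℕ) (F G : MvPolynomial τ ℂ) :
    mvComposition κ (taylorPiece κ F) (taylorPiece κ G) =
      (∏ i, ((κ i).factorial : ℂ))⁻¹ • compositionPoly κ F G := by
  rw [compositionPoly, mvComposition, Finset.smul_sum]
  refine Finset.sum_congr rfl fun α hα => ?_
  have hακ := mem_box_iff.1 hα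
  rw [taylorPiece, taylorPiece, map_smul, map_smul, smul_mul_smul_comm, smul_smul]
  congr 1
  -- the scalar: binom(κ,α) / (binom(κ,κ-α) (κ-α)! binom(κ,α) α!) = 1/κ!
  have hsymm : (∏ i, (((κ i).choose ((κ - α) i)) : ℂ)) = ∏ i, (((κ i).choose (α i) : ℕ) : ℂ) :=
    Finset.prod_congr rfl fun i _ => by rw [Pi.sub_apply, Nat.choose_symm (hακ i)]
  rw [hsymm, mul_inv, mul_inv, show ∀ a b c d e : ℂ, a * (b * c * (d * e)) = (a * d) * (b * (c * e)) from
    fun a b c d e => by ring, mul_inv_cancel₀ (prod_choose_box_ne_zero hακ), one_mul, ← mul_inv, ← mul_inv,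
    ← Finset.prod_mul_distrib, ← Finset.prod_mul_distrib]
  congr 1
  refine Finset.prod_congr rfl fun i _ => ?_
  rw [Pi.sub_apply, ← Nat.cast_mul, ← Nat.cast_mul, ← Nat.choose_mul_factorial_mul_factorial (hακ i)]
  push_cast
  ring

/-- **`F(z,w)` is `ℋ`-stable or identically zero** when `F, G ∈ ℂ_κ[z]` are `ℋ`-stable — Corollary 3.4 (a)
applied to `F(z+w)` and `G(z+w)` ("by Corollary (master-comp) also the polynomial `F(z,w)` … unless it is
identically zero"). [cite: BorceaBranden2009II, §5 proof of Thm. 5.8; §3 Cor. 3.4 (a)] -/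
theorem compositionPoly_eq_zero_or_stable {κ : τ → ℕ} {F G : MvPolynomial τ ℂ} (hF : ∀ i, degreeOf i F ≤ κ i)
    (hG : ∀ i, degreeOf i G ≤ κ i) (hFs : IsUpperHalfPlaneStable F) (hGs : IsUpperHalfPlaneStable G) :
    compositionPoly κ F G = 0 ∨ IsUpperHalfPlaneStable (compositionPoly κ F G) := by
  have h := mv_master_composition' (taylorPiece κ F) (taylorPiece κ G)
    (by rw [mvCompositionF_taylorPiece hF]; exact hFs.sumSubst)
    (by rw [mvCompositionG_taylorPiece hG]; exact hGs.sumSubst)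
  rw [mvComposition_taylorPiece] at h
  have hc : (∏ i, ((κ i).factorial : ℂ))⁻¹ ≠ 0 := inv_ne_zero (prod_factorial_box_ne_zero κ)
  rcases h with h | h
  · exact Or.inl ((smul_eq_zero.1 h).resolve_left hc)
  · exact Or.inr ((isUpperHalfPlaneStable_smul_iff hc).1 h)

end Composition

/-! ## §8 `F(z,w) ≢ 0`: the top homogeneous component -/

section NonVanishing

/-- If `∂^γ f = 0` for a stable `f` then also `∂^γ f_H = 0`. [cite: BorceaBranden2009II, §5 Lemma 5.7] -/
theorem IsUpperHalfPlaneStable.mixedPderiv_homogeneousComponent_eq_zero {f : MvPolynomial τ ℂ}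
    (hf : IsUpperHalfPlaneStable f) {γ : τ → ℕ} (hγ : mixedPderiv γ f = 0) :
    mixedPderiv γ (homogeneousComponent f.totalDegree f) = 0 := by
  have h := hf.homogeneousPart_mixedPderiv γ
  rw [hγ, map_zero] at h
  exact h.symm

omit [DecidableEq τ] in
/-- `|κ - α| + |α| = |κ|` on the box. [folklore] -/
private theorem sum_sub_add_sum {κ α : τ → ℕ} (hα : ∀ i, α i ≤ κ i) :
    ∑ i, (κ - α) i + ∑ i, α i = ∑ i, κ i := by
  rw [← Finset.sum_add_distrib]
  exact Finset.sum_congr rfl fun i _ => by rw [Pi.sub_apply, Nat.sub_add_cancel (hα i)]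

/-- **The top homogeneous component of `F(z,w)` is `F` built from the homogeneous parts**: with `d = deg F`,
`e = deg G`, `|κ| ≤ d + e`: `F(z,w)_{d+e-|κ|} = Σ_{α ≤ κ} ∂^{κ-α}G_H(z) · ∂^α F_H(w)` ("by Lemma (hom-part) …
all non-zero coefficients in its homogeneous part have the same phase as those in the homogeneous part of
`f(w-iε)g(-z+iε)`"). [cite: BorceaBranden2009II, §5 proof of Thm. 5.8] -/
theorem homogeneousComponent_compositionPoly {κ : τ → ℕ} {F G : MvPolynomial τ ℂ}
    (hFs : IsUpperHalfPlaneStable F) (hGs : IsUpperHalfPlaneStable G)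
    (hκ : ∑ i, κ i ≤ F.totalDegree + G.totalDegree) :
    homogeneousComponent (F.totalDegree + G.totalDegree - ∑ i, κ i) (compositionPoly κ F G) =
      compositionPoly κ (homogeneousComponent F.totalDegree F) (homogeneousComponent G.totalDegree G) := by
  rw [compositionPoly, compositionPoly, map_sum]
  refine Finset.sum_congr rfl fun α hα => ?_
  have hακ := mem_box_iff.1 hα
  by_cases hGα : mixedPderiv (κ - α) G = 0
  · rw [hGα, hGs.mixedPderiv_homogeneousComponent_eq_zero hGα, map_zero, zero_mul, zero_mul, map_zero]
  by_cases hFα : mixedPderiv α F = 0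
  · rw [hFα, hFs.mixedPderiv_homogeneousComponent_eq_zero hFα, map_zero, mul_zero, mul_zero, map_zero]
  obtain ⟨hleG, hdegG⟩ := hGs.totalDegree_mixedPderiv hGα
  obtain ⟨hleF, hdegF⟩ := hFs.totalDegree_mixedPderiv hFα
  have hsum := sum_sub_add_sum hακ
  have hN : F.totalDegree + G.totalDegree - ∑ i, κ i =
      (G.totalDegree - ∑ i, (κ - α) i) + (F.totalDegree - ∑ i, α i) := by omega
  rw [hN, homogeneousComponent_mul_of_totalDegree_le ((totalDegree_rename_le _ _).trans hdegG.le)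
      ((totalDegree_rename_le _ _).trans hdegF.le), ← rename_homogeneousComponent, ← rename_homogeneousComponent,
    homogeneousComponent_mixedPderiv, homogeneousComponent_mixedPderiv, Nat.sub_add_cancel hleG,
    Nat.sub_add_cancel hleF]

/-- **`F(z,w)` is not identically zero** as soon as `∂^{α₀} F ≠ 0` and `∂^{κ-α₀} G ≠ 0` for some `α₀ ≤ κ`
(`F`, `G` stable): its top component is a sum of products of one phase, one of them nonzero ("By the
assumptions on the supports of `f` and `g` there is an `α` such that `G_α(z,w) ≠ 0` so
`lim_{t→∞} t^{-d-e+|κ|} F(tz,tw) ≠ 0`"). [cite: BorceaBranden2009II, §5 proof of Thm. 5.8] -/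
theorem compositionPoly_ne_zero {κ : τ → ℕ} {F G : MvPolynomial τ ℂ} (hFs : IsUpperHalfPlaneStable F)
    (hGs : IsUpperHalfPlaneStable G) {α₀ : τ → ℕ} (hα₀ : ∀ i, α₀ i ≤ κ i) (hFα : mixedPderiv α₀ F ≠ 0)
    (hGα : mixedPderiv (κ - α₀) G ≠ 0) : compositionPoly κ F G ≠ 0 := by
  have hF0 : F ≠ 0 := fun h => hFα (by rw [h, map_zero])
  have hG0 : G ≠ 0 := fun h => hGα (by rw [h, map_zero])
  have hF₁s := hFs.homogeneousComponent_totalDegree hF0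
  have hG₁s := hGs.homogeneousComponent_totalDegree hG0
  obtain ⟨u, hu, hFph⟩ :=
    (hF₁s.hasSamePhase (homogeneousComponent_isHomogeneous F.totalDegree F)).exists_hasPhase
  obtain ⟨v, hv, hGph⟩ :=
    (hG₁s.hasSamePhase (homogeneousComponent_isHomogeneous G.totalDegree G)).exists_hasPhase
  obtain ⟨hleF, -⟩ := hFs.totalDegree_mixedPderiv hFα
  obtain ⟨hleG, -⟩ := hGs.totalDegree_mixedPderiv hGα
  have hsum := sum_sub_add_sum hα₀
  intro hzero
  have htop := homogeneousComponent_compositionPoly hFs hGs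
    (by rw [← hsum, add_comm F.totalDegree]; exact add_le_add hleG hleF)
  rw [hzero, map_zero] at htop
  refine HasPhase.sum_ne_zero (u := v * u) (by rw [norm_mul, hu, hv, mul_one])
    (fun α _ => ((hGph.mixedPderiv (κ - α)).rename Sum.inl_injective).mul
      ((hFph.mixedPderiv α).rename Sum.inr_injective)) (mem_box_iff.2 hα₀) ?_ htop.symm
  exact mul_ne_zero
    ((map_ne_zero_iff _ (rename_injective _ Sum.inl_injective)).2
      (hGs.mixedPderiv_homogeneousComponent_ne_zero hGα))
    ((map_ne_zero_iff _ (rename_injective _ Sum.inr_injective)).2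
      (hFs.mixedPderiv_homogeneousComponent_ne_zero hFα))

/-- **`F(z,w)` is `ℋ`-stable** for `ℋ`-stable `F, G ∈ ℂ_κ[z]` with `∂^{α₀}F ≠ 0 ≠ ∂^{κ-α₀}G` for some
`α₀ ≤ κ` — the two halves of the proof of Theorem 5.8 combined. [cite: BorceaBranden2009II, §5 proof of
Thm. 5.8] -/
theorem isUpperHalfPlaneStable_compositionPoly {κ : τ → ℕ} {F G : MvPolynomial τ ℂ}
    (hF : ∀ i, degreeOf i F ≤ κ i) (hG : ∀ i, degreeOf i G ≤ κ i) (hFs : IsUpperHalfPlaneStable F)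
    (hGs : IsUpperHalfPlaneStable G) {α₀ : τ → ℕ} (hα₀ : ∀ i, α₀ i ≤ κ i) (hFα : mixedPderiv α₀ F ≠ 0)
    (hGα : mixedPderiv (κ - α₀) G ≠ 0) : IsUpperHalfPlaneStable (compositionPoly κ F G) :=
  (compositionPoly_eq_zero_or_stable hF hG hFs hGs).resolve_left (compositionPoly_ne_zero hFs hGs hα₀ hFα hGα)

end NonVanishing

/-! ## §9 Affine changes of variables and mixed derivatives -/

section Affine

omit [Fintype τ] [DecidableEq τ] in
/-- `f(az + b) = 0` iff `f = 0` (`a ≠ 0`). [cite: BorceaBranden2009II, §1 Lemma 1.8 (`Φ_κ` invertible)] -/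
theorem affineSubst_eq_zero_iff {a : ℂ} (ha : a ≠ 0) (b : ℂ) (q : MvPolynomial τ ℂ) :
    affineSubst a b q = 0 ↔ q = 0 := by
  refine ⟨fun h => ?_, fun h => by rw [h, map_zero]⟩
  have h' : q = affineSubst a⁻¹ (-(a⁻¹ * b)) (affineSubst a b q) := by
    rw [affineSubst_affineSubst, mul_inv_cancel₀ ha, show a * -(a⁻¹ * b) + b = 0 by field_simp; ring,
      affineSubst_one_zero]
  rw [h', h, map_zero]

/-- **`∂^β` and dilations**: `∂^β [q(az)] = a^{|β|} (∂^β q)(az)`. [cite: BorceaBranden2009II, §5 Lemma 5.4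
(affine `φ_i`)] -/
theorem mixedPderiv_affineSubst_zero (a : ℂ) (β : τ → ℕ) (q : MvPolynomial τ ℂ) :
    mixedPderiv β (affineSubst a 0 q) = a ^ (∑ i, β i) • affineSubst a 0 (mixedPderiv β q) := by
  ext m
  rw [coeff_mixedPderiv, coeff_affineSubst_zero, coeff_smul, coeff_affineSubst_zero, coeff_mixedPderiv,
    smul_eq_mul]
  have hdeg : (∑ i, (m + toF β) i) = (∑ i, m i) + ∑ i, β i := by
    rw [← Finset.sum_add_distrib]
    rfl
  rw [hdeg, pow_add]
  ring

/-- **`∂^β` and affine substitutions**: `∂^β [q(az + b)] = a^{|β|} (∂^β q)(az + b)`.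
[cite: BorceaBranden2009II, §5 Lemma 5.4 (affine `φ_i`)] -/
theorem mixedPderiv_affineSubst (a b : ℂ) (β : τ → ℕ) (q : MvPolynomial τ ℂ) :
    mixedPderiv β (affineSubst a b q) = a ^ (∑ i, β i) • affineSubst a b (mixedPderiv β q) := by
  have h : ∀ p : MvPolynomial τ ℂ, affineSubst a b p = affineSubst a 0 (affineSubst 1 b p) := fun p => by
    rw [affineSubst_affineSubst, one_mul, one_mul, zero_add]
  rw [h q, mixedPderiv_affineSubst_zero, mixedPderiv_affineSubst_one, ← h]

end Affine

/-! ## §10 Theorem 5.8 -/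

section Main

omit [DecidableEq τ] in
/-- `F(z,w)` at a diagonal point `z = w = (c,…,c)`. [cite: BorceaBranden2009II, §5 proof of Thm. 5.8
("setting `z = w = iε`")] -/
theorem eval_const_compositionPoly [DecidableEq τ] (κ : τ → ℕ) (F G : MvPolynomial τ ℂ) (c : ℂ) :
    eval (fun _ => c) (compositionPoly κ F G) = ∑ α ∈ Fintype.piFinset (fun i => range (κ i + 1)),
      eval (fun _ => c) (mixedPderiv (κ - α) G) * eval (fun _ => c) (mixedPderiv α F) := by
  rw [compositionPoly, map_sum]
  refine Finset.sum_congr rfl fun α _ => ?_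
  rw [map_mul, eval_rename, eval_rename]
  rfl

omit [DecidableEq τ] in
/-- Signs on the box: `(-1)^{|κ-α|} = (-1)^{|κ|} (-1)^{|α|}`. [folklore] -/
private theorem neg_one_pow_sub {κ α : τ → ℕ} (hα : ∀ i, α i ≤ κ i) :
    ((-1 : ℂ)) ^ (∑ i, (κ - α) i) = (-1) ^ (∑ i, κ i) * (-1) ^ (∑ i, α i) := by
  rw [← sum_sub_add_sum hα, pow_add, mul_assoc, ← pow_add, ← two_mul, pow_mul, neg_one_sq, one_pow, mul_one]

/-- **Borcea–Brändén II, Theorem 5.8 (half-plane apolarity), normalized form.** Let `κ ∈ ℕⁿ`, `ε > 0` and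
`f, g ∈ ℂ_κ[z_1,…,z_n]`. If `f` has no zero in `{Im z > -ε}ⁿ` (i.e. `f(z - iε)` is `H_0`-stable), `g` has no zero
in `{Im z < ε}ⁿ` (i.e. `g(-z + iε)` is `H_0`-stable), and `κ ≤ α + β` for some `α ∈ supp(f)`, `β ∈ supp(g)`, then
`{f,g}_κ ≠ 0`. This is the situation "we may assume that there is an `ε > 0` such that `f(z-iε)` and `g(-z+iε)`
are `H_0`-stable" to which the printed proof reduces; see the module docstring for the printed hypothesis
"`C_1 ∩ C_2 ≠ ∅`", which is too weak. Proof as printed: the master composition theorem makes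
`F(z,w) = Σ_α (-1)^{κ-α} f^{(α)}(w-iε) g^{(κ-α)}(-z+iε)` stable unless identically zero, its top homogeneous
component is a non-trivial sum of polynomials of one phase (Lemma 5.7 and the same-phase lemma), and
`F(iε, iε) = (-1)^{|κ|} {f,g}_κ`. [cite: BorceaBranden2009II, §5 Thm. 5.8] -/
theorem BorceaBranden_halfPlane_apolarity {κ : τ → ℕ} {f g : MvPolynomial τ ℂ} (hf : ∀ i, degreeOf i f ≤ κ i)
    (hg : ∀ i, degreeOf i g ≤ κ i) {ε : ℝ} (hε : 0 < ε)
    (hfs : ∀ z : τ → ℂ, (∀ i, -ε < (z i).im) → eval z f ≠ 0)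
    (hgs : ∀ z : τ → ℂ, (∀ i, (z i).im < ε) → eval z g ≠ 0)
    (hsupp : ∃ α ∈ f.support, ∃ β ∈ g.support, ∀ i, κ i ≤ α i + β i) :
    mvApolarForm κ f g ≠ 0 := by
  obtain ⟨α, hα, β, hβ, hαβ⟩ := hsupp
  -- the normalized polynomials `F(w) = f(w - iε)`, `G(z) = g(-z + iε)`
  set F := affineSubst 1 (-(Complex.I * ε)) f with hFdef
  set G := affineSubst (-1) (Complex.I * ε) g with hGdef
  have hF : ∀ i, degreeOf i F ≤ κ i := fun i => (degreeOf_affineSubst_le _ _ f i).trans (hf i)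
  have hG : ∀ i, degreeOf i G ≤ κ i := fun i => (degreeOf_affineSubst_le _ _ g i).trans (hg i)
  have hFs : IsUpperHalfPlaneStable F := fun z hz => by
    rw [hFdef, eval_affineSubst]
    exact hfs _ fun i => by
      have := hz i
      simp only [one_mul, Complex.add_im, Complex.neg_im, Complex.mul_im, Complex.I_re, Complex.I_im,
        Complex.ofReal_re, Complex.ofReal_im, zero_mul, one_mul]
      linarith
  have hGs : IsUpperHalfPlaneStable G := fun z hz => by
    rw [hGdef, eval_affineSubst]
    exact hgs _ fun i => by
      have := hz i
      simp only [neg_mul, one_mul, Complex.add_im, Complex.neg_im, Complex.mul_im, Complex.I_re, Complex.I_im,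
        Complex.ofReal_re, Complex.ofReal_im, zero_mul, one_mul]
      linarith
  -- the multi-index `α₀ = min(α, κ)`: `∂^{α₀} f ≠ 0`, `∂^{κ-α₀} g ≠ 0`
  set α₀ : τ → ℕ := fun i => min (α i) (κ i) with hα₀def
  have hα₀ : ∀ i, α₀ i ≤ κ i := fun i => min_le_right _ _
  have hfα : mixedPderiv α₀ f ≠ 0 :=
    (mixedPderiv_ne_zero_iff α₀ f).2 ⟨α, hα, Finsupp.le_def.2 fun i => by
      rw [toF_apply]; exact min_le_left _ _⟩
  have hgα : mixedPderiv (κ - α₀) g ≠ 0 :=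
    (mixedPderiv_ne_zero_iff _ g).2 ⟨β, hβ, Finsupp.le_def.2 fun i => by
      rw [toF_apply, Pi.sub_apply]
      show κ i - min (α i) (κ i) ≤ β i
      have := hαβ i
      rcases min_choice (α i) (κ i) with h | h <;> rw [h] <;> omega⟩
  have hFα : mixedPderiv α₀ F ≠ 0 := by
    rw [hFdef, mixedPderiv_affineSubst, one_pow, one_smul, Ne, affineSubst_eq_zero_iff one_ne_zero]
    exact hfα
  have hGα : mixedPderiv (κ - α₀) G ≠ 0 := by
    rw [hGdef, mixedPderiv_affineSubst]
    refine smul_ne_zero (pow_ne_zero _ (neg_ne_zero.2 one_ne_zero)) ?_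
    rw [Ne, affineSubst_eq_zero_iff (neg_ne_zero.2 one_ne_zero)]
    exact hgα
  -- `F(z,w)` is stable, hence nonzero at `z = w = iε`
  have hst := isUpperHalfPlaneStable_compositionPoly hF hG hFs hGs hα₀ hFα hGα
  have hval := hst (fun _ => Complex.I * ε) fun _ => by simpa using hε
  -- `F(iε, iε) = (-1)^{|κ|} {f,g}_κ`
  have hevF : ∀ γ : τ → ℕ, eval (fun _ : τ => Complex.I * ε) (mixedPderiv γ F) =
      (∏ i, ((γ i).factorial : ℂ)) * coeff (toF γ) f := by
    intro γ
    rw [hFdef, mixedPderiv_affineSubst, one_pow, one_smul, eval_affineSubst,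
      show (fun i : τ => (1 : ℂ) * (Complex.I * ε) + -(Complex.I * ε)) = 0 from funext fun i => by simp,
      eval_zero_mixedPderiv]
  have hevG : ∀ γ : τ → ℕ, eval (fun _ : τ => Complex.I * ε) (mixedPderiv γ G) =
      (-1) ^ (∑ i, γ i) * ((∏ i, ((γ i).factorial : ℂ)) * coeff (toF γ) g) := by
    intro γ
    rw [hGdef, mixedPderiv_affineSubst, smul_eval, eval_affineSubst,
      show (fun i : τ => (-1 : ℂ) * (Complex.I * ε) + Complex.I * ε) = 0 from funext fun i => by simp,
      eval_zero_mixedPderiv]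
  have hev : eval (fun _ : τ ⊕ τ => Complex.I * ε) (compositionPoly κ F G) =
      (-1) ^ (∑ i, κ i) * mvApolarForm κ f g := by
    rw [eval_const_compositionPoly, mvApolarForm_def, Finset.mul_sum]
    refine Finset.sum_congr rfl fun γ hγ => ?_
    rw [hevF, hevG, neg_one_pow_sub (mem_box_iff.1 hγ), Finset.prod_congr rfl fun i _ => Nat.cast_mul _ _,
      Finset.prod_mul_distrib]
    simp only [Pi.sub_apply]
    ring
  rw [hev] at hval
  exact right_ne_zero_of_mul hval

/-- **Theorem 5.8 for a pair of parallel open half-planes covering `ℂ`**: with `φ(t) = at + b` (`a ≠ 0`),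
`C_1 = φ({Im t > -ε})`, `C_2 = φ({Im t < ε})` (so `C_1 ∪ C_2 = ℂ`): if `f ∈ ℂ_κ[z]` has no zero in `C_1ⁿ`, `g ∈ ℂ_κ[z]`
no zero in `C_2ⁿ`, and `κ ≤ α + β` for some `α ∈ supp(f)`, `β ∈ supp(g)`, then `{f,g}_κ ≠ 0` ("By an affine
transformation of the variables we may assume …"; Lemma 5.4: `{f(az+b), g(az+b)}_κ = a^{|κ|}{f,g}_κ`).
[cite: BorceaBranden2009II, §5 Thm. 5.8, Lemma 5.4] -/
theorem BorceaBranden_halfPlane_apolarity_affine {κ : τ → ℕ} {f g : MvPolynomial τ ℂ}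
    (hf : ∀ i, degreeOf i f ≤ κ i) (hg : ∀ i, degreeOf i g ≤ κ i) {a : ℂ} (ha : a ≠ 0) (b : ℂ) {ε : ℝ}
    (hε : 0 < ε) (hfs : ∀ t : τ → ℂ, (∀ i, -ε < (t i).im) → eval (fun i => a * t i + b) f ≠ 0)
    (hgs : ∀ t : τ → ℂ, (∀ i, (t i).im < ε) → eval (fun i => a * t i + b) g ≠ 0)
    (hsupp : ∃ α ∈ f.support, ∃ β ∈ g.support, ∀ i, κ i ≤ α i + β i) :
    mvApolarForm κ f g ≠ 0 := by
  obtain ⟨α, hα, β, hβ, hαβ⟩ := hsupp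
  -- transport the support hypothesis through `∂^{α₀}`, `α₀ = min(α,κ)`
  set α₀ : τ → ℕ := fun i => min (α i) (κ i) with hα₀def
  have hfα : mixedPderiv α₀ f ≠ 0 :=
    (mixedPderiv_ne_zero_iff α₀ f).2 ⟨α, hα, Finsupp.le_def.2 fun i => by
      rw [toF_apply]; exact min_le_left _ _⟩
  have hgα : mixedPderiv (κ - α₀) g ≠ 0 :=
    (mixedPderiv_ne_zero_iff _ g).2 ⟨β, hβ, Finsupp.le_def.2 fun i => by
      rw [toF_apply, Pi.sub_apply]
      show κ i - min (α i) (κ i) ≤ β i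
      have := hαβ i
      rcases min_choice (α i) (κ i) with h | h <;> rw [h] <;> omega⟩
  have hfα' : mixedPderiv α₀ (affineSubst a b f) ≠ 0 := by
    rw [mixedPderiv_affineSubst]
    refine smul_ne_zero (pow_ne_zero _ ha) ?_
    rw [Ne, affineSubst_eq_zero_iff ha]
    exact hfα
  have hgα' : mixedPderiv (κ - α₀) (affineSubst a b g) ≠ 0 := by
    rw [mixedPderiv_affineSubst]
    refine smul_ne_zero (pow_ne_zero _ ha) ?_
    rw [Ne, affineSubst_eq_zero_iff ha]
    exact hgα
  obtain ⟨α', hα', hle1⟩ := (mixedPderiv_ne_zero_iff _ _).1 hfα'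
  obtain ⟨β', hβ', hle2⟩ := (mixedPderiv_ne_zero_iff _ _).1 hgα'
  have key := BorceaBranden_halfPlane_apolarity (κ := κ)
    (fun i => (degreeOf_affineSubst_le a b f i).trans (hf i)) (fun i => (degreeOf_affineSubst_le a b g i).trans (hg i))
    hε (fun z hz => by rw [eval_affineSubst]; exact hfs z hz) (fun z hz => by rw [eval_affineSubst]; exact hgs z hz)
    ⟨α', hα', β', hβ', fun i => by
      have h1 := Finsupp.le_def.1 hle1 i
      have h2 := Finsupp.le_def.1 hle2 i
      rw [toF_apply] at h1 h2
      rw [Pi.sub_apply] at h2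
      omega⟩
  rw [mvApolarForm_affineSubst hf hg] at key
  exact right_ne_zero_of_mul key

end Main

/-! ## §11 The printed hypothesis "`C_1 ∩ C_2 ≠ ∅`" does not suffice -/

section Counterexample

/-- The exponent box of `κ = 1` in one variable is `{0, 1}`. [folklore] -/
private theorem box_unit_one :
    Fintype.piFinset (fun _ : Unit => range ((fun _ : Unit => 1) () + 1)) =
      {(fun _ : Unit => 0), (fun _ : Unit => 1)} := by
  ext m
  rw [Fintype.mem_piFinset, Finset.mem_insert, Finset.mem_singleton]
  constructor
  · intro h
    have h0 : m () < 2 := by simpa using h ()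
    have hm : m = fun _ => m () := funext fun u => by cases u; rfl
    rcases Nat.lt_succ_iff.1 h0 |>.lt_or_eq with h1 | h1
    · left; rw [hm, Nat.lt_one_iff.1 h1]
    · right; rw [hm, h1]
  · rintro (rfl | rfl) <;> intro u <;> simp

/-- **`{z - a, z - b}_1 = b - a`** (one variable, `κ = 1`). [cite: BorceaBranden2009II, §5 (the univariate form
`{f,g}_n = Σ_k (-1)^k f^{(k)}(0) g^{(n-k)}(0)`)] -/
theorem mvApolarForm_one_X_sub_C (a b : ℂ) :
    mvApolarForm (fun _ : Unit => 1) (X () - C a) (X () - C b) = b - a := by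
  have hne : (fun _ : Unit => (0 : ℕ)) ≠ fun _ => 1 := fun h => absurd (congr_fun h ()) (by simp)
  have h0 : toF (fun _ : Unit => (0 : ℕ)) = 0 := Finsupp.ext fun _ => rfl
  have h1 : toF (fun _ : Unit => (1 : ℕ)) = Finsupp.single () 1 := Finsupp.ext fun u => by
    cases u; rw [toF_apply, Finsupp.single_eq_same]
  have h10 : ((fun _ : Unit => (1 : ℕ)) - fun _ => 0) = fun _ => 1 := funext fun _ => rfl
  have h11 : ((fun _ : Unit => (1 : ℕ)) - fun _ => 1) = fun _ => 0 := funext fun _ => rfl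
  have hc0 : ∀ c : ℂ, coeff (0 : Unit →₀ ℕ) (X () - C c : MvPolynomial Unit ℂ) = -c := fun c => by
    rw [coeff_sub, coeff_zero_X, coeff_zero_C, zero_sub]
  have hs : (0 : Unit →₀ ℕ) ≠ Finsupp.single () 1 := (Finsupp.single_ne_zero.2 one_ne_zero).symm
  have hc1 : ∀ c : ℂ, coeff (Finsupp.single () 1) (X () - C c : MvPolynomial Unit ℂ) = 1 := fun c => by
    rw [coeff_sub, coeff_X, if_pos rfl, coeff_C, if_neg hs, sub_zero]
  rw [mvApolarForm_def, box_unit_one, Finset.sum_pair hne, h10, h11, h0, h1, hc0, hc1, hc0, hc1]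
  simp only [Finset.univ_unique, PUnit.default_eq_unit, Finset.sum_singleton, pow_zero, Nat.factorial_zero,
    Nat.factorial_one, mul_one, Finset.prod_singleton, one_mul, pow_one]
  ring

/-- **The printed hypothesis of Theorem 5.8 is too weak.** With the open half-planes `C_1 = {Im z > 0}` and
`C_2 = {Im z > Re z}` (non-empty intersection, e.g. `i`), `n = 1`, `κ = 1`, `f = g = z - (1 - i)` (`1 - i ∉ C_1 ∪ C_2`):
`f` is `C_1`-stable, `g` is `C_2`-stable, `κ ≤ α + β` for `α = β = 1` in the supports, yet `{f,g}_κ = 0`. What the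
printed proof uses (and `BorceaBranden_halfPlane_apolarity` assumes) is `C_1 ∪ C_2 = ℂ`.
[cite: BorceaBranden2009II, §5 Thm. 5.8 (statement, "two open half-planes with non-empty intersection")] -/
theorem BorceaBranden_thm_5_8_printed_hypothesis_counterexample :
    ∃ f g : MvPolynomial Unit ℂ, (∀ i, degreeOf i f ≤ (fun _ : Unit => 1) i) ∧
      (∀ i, degreeOf i g ≤ (fun _ : Unit => 1) i) ∧
      (∃ w : ℂ, 0 < w.im ∧ w.re < w.im) ∧
      (∀ z : Unit → ℂ, (∀ i, 0 < (z i).im) → eval z f ≠ 0) ∧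
      (∀ z : Unit → ℂ, (∀ i, (z i).re < (z i).im) → eval z g ≠ 0) ∧
      (∃ α ∈ f.support, ∃ β ∈ g.support, ∀ i, (fun _ : Unit => 1) i ≤ α i + β i) ∧
      mvApolarForm (fun _ : Unit => 1) f g = 0 := by
  have hdeg : ∀ i : Unit, degreeOf i (X () - C (1 - Complex.I) : MvPolynomial Unit ℂ) ≤ 1 := fun i => by
    cases i
    refine (degreeOf_sub_le () _ _).trans (max_le ?_ ?_)
    · rw [degreeOf_X_self]
    · rw [degreeOf_C]; exact Nat.zero_le _
  have hs : (0 : Unit →₀ ℕ) ≠ Finsupp.single () 1 := (Finsupp.single_ne_zero.2 one_ne_zero).symm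
  have hsupp : Finsupp.single () 1 ∈ (X () - C (1 - Complex.I) : MvPolynomial Unit ℂ).support := by
    rw [mem_support_iff, coeff_sub, coeff_X, if_pos rfl, coeff_C, if_neg hs, sub_zero]
    exact one_ne_zero
  refine ⟨X () - C (1 - Complex.I), X () - C (1 - Complex.I), hdeg, hdeg, ⟨Complex.I, by simp, by simp⟩, ?_, ?_,
    ⟨_, hsupp, _, hsupp, fun i => by
      cases i
      rw [Finsupp.single_eq_same]
      norm_num⟩, ?_⟩
  · intro z hz h
    have h' : z () = 1 - Complex.I := by
      rw [map_sub, eval_X, eval_C, sub_eq_zero] at h; exact h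
    have := hz ()
    rw [h'] at this
    norm_num at this
  · intro z hz h
    have h' : z () = 1 - Complex.I := by
      rw [map_sub, eval_X, eval_C, sub_eq_zero] at h; exact h
    have := hz ()
    rw [h'] at this
    norm_num at this
  · rw [mvApolarForm_one_X_sub_C, sub_self]

end Counterexample

end Literature.Combinatorics.StablePolynomials

end
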